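import Mathlib
import HarnessLib
import Summits.SmoothPoincare4.SmoothPoincare4.Theses.VerlindeRLinks
import Literature.Topology.FourManifolds.RLinkSphere
import Literature.Topology.FourManifolds.RLinkSphereHomotopySphere
import Literature.Topology.FourManifolds.GluingProofs
import Literature.Topology.FourManifolds.FreeFundamentalGroupThreeManifoldHempel
import Literature.Topology.FourManifolds.SphereTwoProdCircleSumUniqueness

/-!
# Birth skeleton (BC3) — crux `VerlindeRLinks.VrlComponentsHBallSlice` (stmt-SmoothPoincare4-15874)

Route `route-SmoothPoincare4-VerlindeRLinks`, crux #9 `VrlComponentsHBallSlice` (a formalisation obligation of the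
negative-side assembly, Gompf–Scharlemann–Thompson 2010, Prop. 2.3 (Hillman), componentwise): for every R-link
`L ⊂ S³` (`n` components, the integral surgery `Y` on `L` satisfies `IsSphereTwoProdCircleSum n Y`, i.e.
`Y ≅ #ⁿ(S² × S¹)`), every component `L.component i` is slice in a homotopy `4`-ball
(`Knot.IsHomotopyBallSlice`: it bounds a smooth proper disc in `Σ ∖ e(B̊⁴)` for a closed smooth `Σ ≃ S⁴`).

THE LINE = GST's printed proof, typed over the tree's R-link-sphere vocabulary (`RLinkSphere.lean`: the compact
trace `FramedLink.IsTrace L P` = `B⁴ ∪_L (2-handles)` and the closed manifold `IsRLinkSphere X L` =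
`trace ∪_φ ♮ⁿ(S¹ × B³)` = `0h ∪ (2-handles along L) ∪ n·(3h) ∪ 4h`), cut along the four classical facts its
roadmap lists and the tree does not yet prove:

* `stub_trace_boundary` (TRACE: existence + `∂(trace) = surgery`; known, size L): every framed link `L` has a
  compact trace `P` (Kosinski multi-attachment of `2`-handles to `𝔻⁴`, `HandleAttachingMap.exists_isMultiAttachment_holds`)
  and the boundary of the trace is diffeomorphic to any integral surgery `Y` on `L` (Kirby 1989, Ch. I §5,
  "`N³ = ∂M_L`"; uniqueness of surgery up to diffeomorphism).
* `stub_oneHandlebody_boundary` (`∂(♮ⁿ S¹ × B³) = #ⁿ(S² × S¹)`; known, size M/L): for every `n` there is a compact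
  connected orientable `4`-dimensional `(1,n)`-handlebody `V : Type` (exists: `exists_oneHandlebody_four n`) with a
  boundary datum whose carrier satisfies the tree's honest recursive recogniser `IsSphereTwoProdCircleSum n` (Kirby
  1989, Ch. I §2, p. 8; the case `n = 1` is the discharged fact
  `nonempty_diffeomorph_boundary_sphereTwo_prod_of_handleCount_one_one_holds`).
* `stub_rLinkSphere_homotopyEquiv_sphere` (`Σ_L ≃ S⁴`; = the NAMED FACT
  `IsRLinkSphere.nonempty_homotopyEquiv_sphere` of `RLinkSphereHomotopySphere.lean`, unproved in the tree; size L):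
  a gluing `P ∪_φ V` of a trace with a `(1,n)`-handlebody is simply connected (no `1`-handles, van Kampen), has
  `χ = 2`, `H₂` free of rank `0`, hence is a homotopy `4`-sphere (GST §9; recognition
  `nonempty_homotopyEquiv_sphere_four_iff`).
* `stub_core_isSliceDiscIn` (CORES; the typed heart of Prop. 2.3, size M): in an R-link sphere `X` every component
  `L.component i` bounds the core of its `2`-handle, a smooth proper disc in `X ∖ e(B̊⁴)` for a (shrunken) `0`-handle
  ball `e` — an `Knot.IsSliceDiscIn (L.component i) X e f` datum (GST: "the cores of the original `n` `2`-handles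
  that are attached to `L` are the required `n` `2`-disks").
* `isHomotopyBallSlice_of_pieces : TRACE-sig → HANDLEBODY-sig → SPHERE-sig → CORES-sig → (crux unfolded)` — THE
  REAL COMPOSITION, sorry-free: transport `IsSphereTwoProdCircleSum n` from `Y` to `∂P`
  (`IsSphereTwoProdCircleSum.of_diffeomorph`), identify `∂P ≅ ∂V` by the tree's uniqueness THEOREM for `#ⁿ(S² × S¹)`
  (`IsSphereTwoProdCircleSum.nonempty_diffeomorph`, Kervaire–Milnor / Hempel), glue (`exists_isBoundaryGluing_holds`,
  Hirsch 8.2.1) to get `X : Type` with `IsRLinkSphere X L` (`IsRLinkSphere.mk`), then the core disc and the homotopy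
  equivalence give `IsHomotopyBallSlice` (`Knot.IsSliceDiscIn.isHomotopyBallSlice`).
* `VrlComponentsHBallSlice_of : VrlComponentsHBallSlice` — THE SKELETON THEOREM: the crux BY NAME from the four
  declared stubs through the composition (the only theorem whose head is the crux; `ledger skeleton check` shape).

`sorry` occurs ONLY in the four `stub_*` theorems.

## Disproof used

None exists: `ledger crux ls stmt-SmoothPoincare4-15874` — no `Disproof.lean`, no dead line, no landed `Negative/`
lemma (2026-08-17); `ledger negatives --problem SmoothPoincare4` has no statement about traces / R-link spheres /
homotopy-ball sliceness of link components. Honours the refuter briefing on the item (true on paper; the Lean cost is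
the compact trace, here `stub_trace_boundary`) and the grounder's vendored fact
`Literature.Topology.FourManifolds.GompfScharlemannThompson2010_prop23` (identical to the crux; deliberately NOT used
as a stub — that would be the crux in costume).

## References

* R. E. Gompf, M. Scharlemann, A. Thompson, Geom. Topol. 14 (2010) 2305–2347 (arXiv:1103.1601), Prop. 2.3 and §9.
  [GompfScharlemannThompson2010]
* R. C. Kirby, *The Topology of 4-Manifolds*, LNM 1374 (1989), Ch. I §2 (p. 8), §5. [Kirby1989]
* F. Laudenbach, V. Poénaru, Bull. SMF 100 (1972) 337–344. [LaudenbachPoenaruBSMF1972]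
* M. Freedman, R. Gompf, S. Morrison, K. Walker, Quantum Topol. 1 (2010), §1. [FreedmanGompfMorrisonWalker2010]
-/

-- `Summit.<Summit>.<Problem>`: single-conjunct summit, the duplicate component is mandated (CONVENTIONS §2).
set_option linter.dupNamespace false
set_option linter.unusedVariables false

noncomputable section

namespace Summit.SmoothPoincare4.SmoothPoincare4.Cruxes.VrlComponentsHBallSlice.Birth

open scoped Manifold ContDiff Topology
open Set Function
open Literature.Topology.FourManifolds
open Summit.SmoothPoincare4.SmoothPoincare4.Theses.VerlindeRLinks

/-! ## The four registered stubs -/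

/-- **Stub TRACE `stub_trace_boundary` — the compact trace of a framed link exists and its boundary is the surgery.**
For every framed link `L ⊂ S³` with `n` components and every closed `3`-manifold `Y` which is an integral surgery on
`L` (`L.IsSurgery (𝓡 3) Y`) there is a compact Hausdorff second-countable smooth `4`-manifold with boundary
`P : Type` which is the trace `B⁴ ∪_L (2-handles)` of `L` (`L.IsTrace P`, `RLinkSphere.lean`) together with a
boundary datum `bP` whose carrier `∂P` is diffeomorphic to `Y`. Why true: the trace exists (Kosinski's simultaneous
attachment, the tree's discharged `HandleAttachingMap.exists_isMultiAttachment_holds`, applied to `𝔻 4` and attaching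
maps built from framed tubes `Knot.exists_tubularNbhd_hasFraming` / `TubeAttachData.attachingMap`); its boundary is
the surgery `S³_L` (Kirby 1989, Ch. I §5: Kosinski's identification restricted to `∂D⁴` is literally the tree's
`surgeryRel`), and integral surgery on a framed link is unique up to diffeomorphism. Known; size L.
[Kirby1989, Ch. I §2 (p. 8), §5] [Kosinski1993, VI §6] [GompfScharlemannThompson2010, §2] -/
theorem stub_trace_boundary :
    ∀ (n : ℕ) (L : FramedLink (Fin n)) (Y : Type) [TopologicalSpace Y] [T2Space Y]
      [SecondCountableTopology Y] [ChartedSpace (EuclideanSpace ℝ (Fin 3)) Y]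
      [IsManifold (𝓡 3) ((⊤ : ℕ∞) : WithTop ℕ∞) Y] [CompactSpace Y] [ConnectedSpace Y],
      L.IsSurgery (𝓡 3) Y →
        ∃ (P : Type) (_ : TopologicalSpace P) (_ : T2Space P) (_ : SecondCountableTopology P)
          (_ : ChartedSpace (EuclideanHalfSpace 4) P) (_ : IsManifold (𝓡∂ 4) ((⊤ : ℕ∞) : WithTop ℕ∞) P)
          (_ : CompactSpace P) (bP : BoundaryData (𝓡∂ 4) P (𝓡 3)),
          L.IsTrace P ∧ Nonempty (bP.carrier ≃ₘ⟮𝓡 3, 𝓡 3⟯ Y) := by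
  sorry

/-- **Stub HANDLEBODY `stub_oneHandlebody_boundary` — `∂(♮ⁿ S¹ × B³) ≅ #ⁿ(S² × S¹)`.** For every `n` there is a
compact connected orientable smooth `4`-manifold with boundary `V : Type` with a handle decomposition into one
`0`-handle and `n` `1`-handles (`HasHandleDecomposition 3 V (handleCount 1 n)`, `IsOrientable (𝓡∂ 4) V`) and a
boundary datum `bV` whose carrier is `#ⁿ(S² × S¹)` in the tree's recursive sense `IsSphereTwoProdCircleSum n`.
Why true: such `V` exist (`exists_oneHandlebody_four n`, the thickened planar handlebodies); the boundary of
`𝔻⁴ ∪ n` orientable `1`-handles is the iterated connected sum of `n` copies of `S² × S¹` (each `1`-handle changes the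
boundary by a `0`-surgery `S⁰ × D³ ↝ D¹ × S²`, i.e. by `# S² × S¹`); `n = 0`: `∂𝔻⁴ = S³`; `n = 1` is the discharged
`nonempty_diffeomorph_boundary_sphereTwo_prod_of_handleCount_one_one_holds`. Known; size M/L (induction on `n` over
the honest connected-sum predicate, or via `π₁(∂V)` free of rank `n` + the conditional H53). [Kirby1989, Ch. I §2 (p. 8)]
[Kosinski1993, VI (11.4)] -/
theorem stub_oneHandlebody_boundary :
    ∀ n : ℕ, ∃ (V : Type) (_ : TopologicalSpace V) (_ : T2Space V) (_ : SecondCountableTopology V)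
      (_ : ChartedSpace (EuclideanHalfSpace 4) V) (_ : IsManifold (𝓡∂ 4) ((⊤ : ℕ∞) : WithTop ℕ∞) V)
      (_ : CompactSpace V) (_ : ConnectedSpace V) (bV : BoundaryData (𝓡∂ 4) V (𝓡 3)),
      HasHandleDecomposition 3 V (handleCount 1 n) ∧ IsOrientable (𝓡∂ 4) V ∧
        IsSphereTwoProdCircleSum n bV.carrier := by
  sorry

/-- **Stub SPHERE `stub_rLinkSphere_homotopyEquiv_sphere` — an R-link sphere is a homotopy `4`-sphere** (verbatim the
named fact `Literature.Topology.FourManifolds.IsRLinkSphere.nonempty_homotopyEquiv_sphere`, unproved in the tree; prove it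
there as `…_holds` and this stub is `exact IsRLinkSphere.nonempty_homotopyEquiv_sphere_holds n L X`). A Hausdorff second
countable smooth `X : Type` with `IsRLinkSphere X L` (`X = P ∪_φ V`, `P` a trace of `L`, `V` a compact connected
orientable `(1,n)`-handlebody) is homotopy equivalent to `S⁴`: no `1`-handles and `π₁(∂V) → π₁(V)` onto give `π₁ = 1`
(van Kampen), `χ = (1 + n) + (1 - n) - 0 = 2`, `H₃ ≅ H¹ = 0`, `H₂` free (UCT) of rank `χ - 2 = 0`, so `X` is a
simply connected homology `4`-sphere, hence `≃ S⁴` (Hurewicz–Whitehead; tree recognition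
`nonempty_homotopyEquiv_sphere_four_iff`). Known (GST §9); size L. [GompfScharlemannThompson2010, §9 and proof of Prop. 9.2] -/
theorem stub_rLinkSphere_homotopyEquiv_sphere :
    ∀ (n : ℕ) (L : FramedLink (Fin n)) (X : Type) [TopologicalSpace X] [T2Space X]
      [SecondCountableTopology X] [ChartedSpace (EuclideanSpace ℝ (Fin 4)) X]
      [IsManifold (𝓡 4) ((⊤ : ℕ∞) : WithTop ℕ∞) X],
      IsRLinkSphere X L →
        Nonempty (ContinuousMap.HomotopyEquiv X (Metric.sphere (0 : EuclideanSpace ℝ (Fin 5)) 1)) := by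
  sorry

/-- **Stub CORES `stub_core_isSliceDiscIn` — in an R-link sphere every component bounds the core of its `2`-handle.**
If `X : Type` is a smooth R-link sphere of `L` (`IsRLinkSphere X L`: `X = P ∪_φ V` with `P = 𝔻⁴ ∪_L (2-handles)`
realised by the dotted-circle-free Kirby diagram of `L`, the `i`-th `2`-handle attached along a framed tubular
neighbourhood of the knot `L.component i ⊂ S³ = ∂𝔻⁴`), then for every `i` there are a smooth ball
`e : ℝ⁴ ↪ X` (the `0`-handle chart, radially shrunken inside `𝔻⁴`) and a smooth map `f : ℝ² → X` with
`(L.component i).IsSliceDiscIn X e f`: `f|𝔻²` is the radial annulus from the shrunken copy `e ∘ K` of the knot out to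
`K ⊂ ∂𝔻⁴` followed by the core `D² × {0}` of the `i`-th `2`-handle — a smooth, injective, immersed disc whose
interior misses the closed shrunken ball `e(𝔻⁴)` and whose boundary circle is `e ∘ (L.component i)`. Why true: GST,
proof of Prop. 2.3 ("the cores of the original `n` `2`-handles that are attached to `L` are the required `n`
`2`-disks"); compare the tree's open-trace version `OpenTrace.isSliceDiscIn`. Size M (handle-model bookkeeping over
`DottedCircleDiagram.Realization` / `HandleAttachingMap.IsMultiAttachment`). [GompfScharlemannThompson2010, Prop. 2.3]
[Kirby1989, Ch. I §2] -/
theorem stub_core_isSliceDiscIn :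
    ∀ (n : ℕ) (L : FramedLink (Fin n)) (X : Type) [TopologicalSpace X] [T2Space X]
      [SecondCountableTopology X] [ChartedSpace (EuclideanSpace ℝ (Fin 4)) X]
      [IsManifold (𝓡 4) ((⊤ : ℕ∞) : WithTop ℕ∞) X],
      IsRLinkSphere X L → ∀ i : Fin n,
        ∃ (e : EuclideanSpace ℝ (Fin 4) → X) (f : EuclideanSpace ℝ (Fin 2) → X),
          (L.component i).IsSliceDiscIn X e f := by
  sorry

/-! ## Sorry-free documentation: the SPHERE stub is literally the named Literature fact -/

/-- The SPHERE stub is, symbol for symbol, the named fact `IsRLinkSphere.nonempty_homotopyEquiv_sphere`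
(`RLinkSphereHomotopySphere.lean`): whoever discharges the fact closes the stub. [GompfScharlemannThompson2010, §9] -/
theorem rLinkSphere_homotopyEquiv_sphere_of_fact (h : IsRLinkSphere.nonempty_homotopyEquiv_sphere) :
    ∀ (n : ℕ) (L : FramedLink (Fin n)) (X : Type) [TopologicalSpace X] [T2Space X]
      [SecondCountableTopology X] [ChartedSpace (EuclideanSpace ℝ (Fin 4)) X]
      [IsManifold (𝓡 4) ((⊤ : ℕ∞) : WithTop ℕ∞) X],
      IsRLinkSphere X L →
        Nonempty (ContinuousMap.HomotopyEquiv X (Metric.sphere (0 : EuclideanSpace ℝ (Fin 5)) 1)) :=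
  fun n L X _ _ _ _ _ hX => h n L X hX

/-! ## The composition: the four stubs prove the crux (GST's proof of Prop. 2.3) -/

/-- **Composition with explicit hypotheses** (`TRACE-sig → HANDLEBODY-sig → SPHERE-sig → CORES-sig →` the crux's
one-step unfolding, so that `VrlComponentsHBallSlice_of` below is the file's only theorem whose head is the crux name).
Proof (Gompf–Scharlemann–Thompson, proof of Prop. 2.3, closed up as in §9): take the trace `P` of `L` with
`∂P ≅ Y` (TRACE) and a `(1,n)`-handlebody `V` with `∂V ≅ #ⁿ(S² × S¹)` (HANDLEBODY); `∂P ≅ Y ≅ #ⁿ(S² × S¹)`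
(`IsSphereTwoProdCircleSum.of_diffeomorph`), so `∂P ≅ ∂V` by the tree's uniqueness theorem for `#ⁿ(S² × S¹)`
(`IsSphereTwoProdCircleSum.nonempty_diffeomorph`); glue along this `φ` (`exists_isBoundaryGluing_holds`) to a closed
smooth `X : Type`, an R-link sphere of `L` (`IsRLinkSphere.mk`), compact (`IsRLinkSphere.compactSpace`), homotopy
equivalent to `S⁴` (SPHERE), in which `L.component i` bounds the core of its `2`-handle off the `0`-handle (CORES):
that is `Knot.IsHomotopyBallSlice` (`Knot.IsSliceDiscIn.isHomotopyBallSlice`). Sorry-free. [GompfScharlemannThompson2010, Prop. 2.3] -/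
theorem isHomotopyBallSlice_of_pieces
    (hT : ∀ (n : ℕ) (L : FramedLink (Fin n)) (Y : Type) [TopologicalSpace Y] [T2Space Y]
      [SecondCountableTopology Y] [ChartedSpace (EuclideanSpace ℝ (Fin 3)) Y]
      [IsManifold (𝓡 3) ((⊤ : ℕ∞) : WithTop ℕ∞) Y] [CompactSpace Y] [ConnectedSpace Y],
      L.IsSurgery (𝓡 3) Y →
        ∃ (P : Type) (_ : TopologicalSpace P) (_ : T2Space P) (_ : SecondCountableTopology P)
          (_ : ChartedSpace (EuclideanHalfSpace 4) P) (_ : IsManifold (𝓡∂ 4) ((⊤ : ℕ∞) : WithTop ℕ∞) P)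
          (_ : CompactSpace P) (bP : BoundaryData (𝓡∂ 4) P (𝓡 3)),
          L.IsTrace P ∧ Nonempty (bP.carrier ≃ₘ⟮𝓡 3, 𝓡 3⟯ Y))
    (hV : ∀ n : ℕ, ∃ (V : Type) (_ : TopologicalSpace V) (_ : T2Space V) (_ : SecondCountableTopology V)
      (_ : ChartedSpace (EuclideanHalfSpace 4) V) (_ : IsManifold (𝓡∂ 4) ((⊤ : ℕ∞) : WithTop ℕ∞) V)
      (_ : CompactSpace V) (_ : ConnectedSpace V) (bV : BoundaryData (𝓡∂ 4) V (𝓡 3)),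
      HasHandleDecomposition 3 V (handleCount 1 n) ∧ IsOrientable (𝓡∂ 4) V ∧
        IsSphereTwoProdCircleSum n bV.carrier)
    (hS : ∀ (n : ℕ) (L : FramedLink (Fin n)) (X : Type) [TopologicalSpace X] [T2Space X]
      [SecondCountableTopology X] [ChartedSpace (EuclideanSpace ℝ (Fin 4)) X]
      [IsManifold (𝓡 4) ((⊤ : ℕ∞) : WithTop ℕ∞) X],
      IsRLinkSphere X L →
        Nonempty (ContinuousMap.HomotopyEquiv X (Metric.sphere (0 : EuclideanSpace ℝ (Fin 5)) 1)))
    (hC : ∀ (n : ℕ) (L : FramedLink (Fin n)) (X : Type) [TopologicalSpace X] [T2Space X]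
      [SecondCountableTopology X] [ChartedSpace (EuclideanSpace ℝ (Fin 4)) X]
      [IsManifold (𝓡 4) ((⊤ : ℕ∞) : WithTop ℕ∞) X],
      IsRLinkSphere X L → ∀ i : Fin n,
        ∃ (e : EuclideanSpace ℝ (Fin 4) → X) (f : EuclideanSpace ℝ (Fin 2) → X),
          (L.component i).IsSliceDiscIn X e f) :
    ∀ (n : ℕ) (L : FramedLink (Fin n)) (Y : Type) [TopologicalSpace Y] [T2Space Y]
      [SecondCountableTopology Y] [ChartedSpace (EuclideanSpace ℝ (Fin 3)) Y]
      [IsManifold (𝓡 3) ((⊤ : ℕ∞) : WithTop ℕ∞) Y] [CompactSpace Y] [ConnectedSpace Y],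
      IsSphereTwoProdCircleSum n Y → L.IsSurgery (𝓡 3) Y →
        ∀ i : Fin n, (L.component i).IsHomotopyBallSlice := by
  intro n L Y _ _ _ _ _ _ _ hY hL i
  -- TRACE: the compact trace `P` of `L`, with `∂P ≅ Y`
  obtain ⟨P, _, _, _, _, _, _, bP, hP, ⟨ψ⟩⟩ := hT n L Y hL
  -- HANDLEBODY: `V ≅ ♮ⁿ S¹ × B³` with `∂V ≅ #ⁿ(S² × S¹)`
  obtain ⟨V, _, _, _, _, _, _, _, bV, hVh, hVo, hbV⟩ := hV n
  haveI : T2Space bP.carrier := bP.isSmoothEmbedding.isEmbedding.t2Space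
  haveI : T2Space bV.carrier := bV.isSmoothEmbedding.isEmbedding.t2Space
  -- `∂P ≅ Y ≅ #ⁿ(S² × S¹) ≅ ∂V`
  have hbP : IsSphereTwoProdCircleSum n bP.carrier := hY.of_diffeomorph ψ.symm
  obtain ⟨φ⟩ := IsSphereTwoProdCircleSum.nonempty_diffeomorph n bP.carrier bV.carrier hbP hbV
  -- glue: `X = P ∪_φ V`, a closed smooth R-link sphere of `L`
  obtain ⟨X, _, _, _, _, _, _, hX⟩ := exists_isBoundaryGluing_holds (n := 3) bP bV φ
  have hR : IsRLinkSphere X L := IsRLinkSphere.mk hP hVh hVo hX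
  -- CORES + SPHERE
  obtain ⟨e, f, hef⟩ := hC n L X hR i
  exact hef.isHomotopyBallSlice (hS n L X hR)

/-- **THE SKELETON THEOREM.** The crux `Summit.SmoothPoincare4.SmoothPoincare4.Theses.VerlindeRLinks.VrlComponentsHBallSlice`,
concluded BY NAME from the four DECLARED stubs `stub_trace_boundary`, `stub_oneHandlebody_boundary`,
`stub_rLinkSphere_homotopyEquiv_sphere`, `stub_core_isSliceDiscIn` (the only `sorry`s of the file) through the sorry-free
composition `isHomotopyBallSlice_of_pieces`. [GompfScharlemannThompson2010, Prop. 2.3] -/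
theorem VrlComponentsHBallSlice_of :
    Summit.SmoothPoincare4.SmoothPoincare4.Theses.VerlindeRLinks.VrlComponentsHBallSlice :=
  isHomotopyBallSlice_of_pieces stub_trace_boundary stub_oneHandlebody_boundary
    stub_rLinkSphere_homotopyEquiv_sphere stub_core_isSliceDiscIn

end Summit.SmoothPoincare4.SmoothPoincare4.Cruxes.VrlComponentsHBallSlice.Birth

end
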